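import Summits.Ventures.Crystal3D.Theorems.StickyWulffConstantGenericWallFloorStackLedgerOneSided
import Summits.Ventures.Crystal3D.Theorems.StickyWulffConstantGenericWallFloorStackWalkInjectiveTiltWide
import Summits.Ventures.Crystal3D.Theorems.StickyWulffConstantGenericWallFloorStackLedgerOneSidedTilt
import HarnessLib

/-!
# The ONE-SIDED stack ledger with a WIDE tilted vertical (`‖z − e₃‖ ≤ 1/3`): slots of `e₃`-component `≥ 9/20` pay half
# their flux, residual-free (crux `GenericWallFloor`, line `WallLedgerG`)

HONEST FRAMING. Venture `Summits/Ventures/Crystal3D` (cell `crystal3d-full`), helper `--supports` the crux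
`GenericWallFloor` (stmt-Ventures-19480), registered line `WallLedgerG`, open stub `stub_twoSlabAdhesion`.  Rung credit
only; F-C1 not moved; NOT the stub.  `twoSlabAdhesion_stackLedger_oneSided_tilt` (19480-p1 g7) VERBATIM with the tilt
`1/4 ↦ 1/3`: drift `24(h+40)`, flux constant `16000`, inner disc `ρ − 3 − 24(h+40)`, toolkit `…StackWalkInjectiveTiltWide`.
Purpose: in-plane slots of planes tilted by `θ` with `(√3/2) sin θ ≥ 9/20` (`sin θ ≥ 0.52`, was `0.60`) — lane F's twin
coverage `80 % ↦ 85 %` of orientations, lane G's one-sided floors on shallower planes.  NOT the stub.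
-/

noncomputable section

namespace Summit.Ventures.Crystal3D.Theorems

open Summit.Ventures.Crystal3D Finset
open Literature.MathematicalPhysics.StatisticalMechanics (fccStacking barlowStacking IsHaggSeq contactDeficiency)
open scoped InnerProductSpace

/-! ### Flux loss for the wide drift -/

/-- **Flux loss of the inner start disc (wide tilted drift).**  For `0 ≤ κ ≤ 2`, `0 ≤ h`, `ρs = ρ − 3 − 24(h + 40)` with
`0 ≤ ρs ≤ ρ − 1`: `κπρ² − 16000(1+h)ρ ≤ κπρs² − 10√2πρs`. -/
theorem flux_loss_inner_disc_wide {κ h ρ ρs : ℝ} (hκ0 : 0 ≤ κ) (hκ2 : κ ≤ 2) (hh : 0 ≤ h) (hρ0 : 0 ≤ ρ)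
    (hρs : ρs = ρ - 3 - 24 * (h + 4 * 10)) (hρs0 : 0 ≤ ρs) (hρsρ : ρs ≤ ρ - 1) :
    κ * Real.pi * ρ ^ 2 - 16000 * (1 + h) * ρ ≤ κ * Real.pi * ρs ^ 2 - 10 * Real.sqrt 2 * Real.pi * ρs := by
  have hπ : Real.pi ≤ 4 := Real.pi_le_four
  have hπ0 : 0 ≤ Real.pi := Real.pi_pos.le
  have hsq : 0 ≤ Real.sqrt 2 := Real.sqrt_nonneg 2
  have hs2' : Real.sqrt 2 ≤ 2 := by
    rw [show (2 : ℝ) = Real.sqrt (2 ^ 2) by rw [Real.sqrt_sq (by norm_num)]]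
    exact Real.sqrt_le_sqrt (by norm_num)
  set L : ℝ := 24 * (h + 4 * 10) with hL
  have hL0 : 0 ≤ L := by rw [hL]; positivity
  have hκπ : κ * Real.pi ≤ 8 := by nlinarith only [hκ0, hκ2, hπ, hπ0]
  have h1 : κ * Real.pi * ρ ^ 2 - κ * Real.pi * ρs ^ 2 = κ * Real.pi * ((3 + L) * (ρ + ρs)) := by
    rw [hρs]; ring
  have h0 : 0 ≤ (3 + L) * (ρ + ρs) := mul_nonneg (by linarith only [hL0]) (by linarith only [hρ0, hρs0])
  have h2 : (3 + L) * (ρ + ρs) ≤ (3 + L) * (2 * ρ) :=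
    mul_le_mul_of_nonneg_left (by linarith only [hρsρ]) (by linarith only [hL0])
  have h3 : κ * Real.pi * ((3 + L) * (ρ + ρs)) ≤ 8 * ((3 + L) * (2 * ρ)) :=
    calc κ * Real.pi * ((3 + L) * (ρ + ρs)) ≤ 8 * ((3 + L) * (ρ + ρs)) :=
          mul_le_mul_of_nonneg_right hκπ h0
      _ ≤ 8 * ((3 + L) * (2 * ρ)) := by linarith only [h2]
  have h4 : 10 * Real.sqrt 2 * Real.pi * ρs ≤ 80 * ρ := by
    have h7 : Real.sqrt 2 * Real.pi ≤ 8 := by nlinarith only [hsq, hs2', hπ, hπ0]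
    have h5 : 10 * Real.sqrt 2 * Real.pi * ρs = 10 * (Real.sqrt 2 * Real.pi) * ρs := by ring
    rw [h5]
    have h6 : 10 * (Real.sqrt 2 * Real.pi) * ρs ≤ 10 * 8 * ρs :=
      mul_le_mul_of_nonneg_right (by linarith only [h7]) hρs0
    linarith only [h6, hρsρ]
  have hhρ : 0 ≤ h * ρ := mul_nonneg hh hρ0
  have h5 : 8 * ((3 + L) * (2 * ρ)) + 80 * ρ ≤ 16000 * (1 + h) * ρ := by
    rw [hL]; linarith only [hρ0, hhρ]
  linarith only [h1, h3, h4, h5]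

/-! ### The wide-tilt one-sided ledger -/

open scoped Classical in
/-- **The one-sided stack ledger with a tilted vertical (grain 1 alone, charge `½κ₁`, no residual).**  See the
module docstring: unit `z` with `‖z − e₃‖ ≤ 1/4`, slot `u₁` steep for `z`, frame set `M₁` containing every frame of
every sound well-formed `z`-stack over `(A₁, u₁, 0)`, and no frame of `M₁` IS the far lattice `A₂·Λ₀`; then in every
cell of `TwoSlabAdhesion` `cross(P₁,X∖P₁) + cross(P₂,Y) ≤ D(Y) + (φ₁ + φ₂ − ½·√2|⟪A₁u₁,e₃⟫|)πρ² + C(1+h)ρ`. -/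
theorem twoSlabAdhesion_stackLedger_oneSided_wide
    {s₀ : EuclideanSpace ℝ (Fin 3)} (hs₀ : s₀ ∈ fccSlots)
    (hcert : ExactOnly 0 (fccSlots.filter fun w => 0 < ⟪w, s₀⟫_ℝ))
    (hDS : ∀ F₁ F₂ : EuclideanSpace ℝ (Fin 3) ≃ₗᵢ[ℝ] EuclideanSpace ℝ (Fin 3), DoubleStarCoaxialAt F₁ F₂)
    (hCP : CapPairCoaxial)
    (A₁ : EuclideanSpace ℝ (Fin 3) ≃ₗᵢ[ℝ] EuclideanSpace ℝ (Fin 3)) (t₁ : EuclideanSpace ℝ (Fin 3))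
    (A₂ : EuclideanSpace ℝ (Fin 3) ≃ₗᵢ[ℝ] EuclideanSpace ℝ (Fin 3)) (t₂ : EuclideanSpace ℝ (Fin 3))
    {z : EuclideanSpace ℝ (Fin 3)} (hz : ‖z‖ = 1) (hze : ‖z - EuclideanSpace.single (2 : Fin 3) (1 : ℝ)‖ ≤ 1 / 3)
    {u₁ : EuclideanSpace ℝ (Fin 3)} (hu₁ : u₁ ∈ fccSlots)
    (hsteep₁ : Real.sqrt 2 / 2 ≤ ⟪A₁ u₁, z⟫_ℝ)
    (M₁ : Set (EuclideanSpace ℝ (Fin 3) ≃ₗᵢ[ℝ] EuclideanSpace ℝ (Fin 3)))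
    (hM₁ : ∀ stk : List WalkEntry, StackSound z stk → StackWF z stk → stk.getLast? = some ⟨A₁, u₁, 0⟩ →
      ∀ e ∈ stk, e.frame ∈ M₁)
    (hfar : ∀ F ∈ M₁, F '' fccStacking 1 (Real.sqrt (2 / 3)) ≠ A₂ '' fccStacking 1 (Real.sqrt (2 / 3))) :
    ∃ C R₀ : ℝ, 1 ≤ R₀ ∧ ∀ h : ℝ, 0 ≤ h → ∀ ρ : ℝ, R₀ ≤ ρ →
      ∀ X P₁ P₂ : Finset (EuclideanSpace ℝ (Fin 3)),
      (∀ p ∈ X, ∀ q ∈ X, p ≠ q → 1 ≤ dist p q) → P₁ ⊆ X → P₂ ⊆ X \ P₁ →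
      (∀ p ∈ X, -(2 * R₀) ≤ p 2 ∧ p 2 ≤ h + 2 * R₀ ∧ p 0 ^ 2 + p 1 ^ 2 ≤ ρ ^ 2) →
      (∀ p, p ∈ P₁ ↔ (p ∈ (fun q => A₁ q + t₁) '' fccStacking 1 (Real.sqrt (2 / 3)) ∧
        -(2 * R₀) ≤ p 2 ∧ p 2 ≤ -R₀ ∧ p 0 ^ 2 + p 1 ^ 2 ≤ ρ ^ 2)) →
      (∀ p, p ∈ P₂ ↔ (p ∈ (fun q => A₂ q + t₂) '' fccStacking 1 (Real.sqrt (2 / 3)) ∧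
        h + R₀ ≤ p 2 ∧ p 2 ≤ h + 2 * R₀ ∧ p 0 ^ 2 + p 1 ^ 2 ≤ ρ ^ 2)) →
      ((((P₁ ×ˢ (X \ P₁)).filter fun pq => dist pq.1 pq.2 = 1).card : ℕ) : ℝ) +
        ((((P₂ ×ˢ ((X \ P₁) \ P₂)).filter fun pq => dist pq.1 pq.2 = 1).card : ℕ) : ℝ) ≤
        contactDeficiency ((X \ P₁) \ P₂) +
          (Real.sqrt 2 / 4 * ∑ᶠ w ∈ {w ∈ fccStacking 1 (Real.sqrt (2 / 3)) | ‖w‖ = 1},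
              |⟪w, A₁.symm (EuclideanSpace.single (2 : Fin 3) (1 : ℝ))⟫_ℝ| +
            Real.sqrt 2 / 4 * ∑ᶠ w ∈ {w ∈ fccStacking 1 (Real.sqrt (2 / 3)) | ‖w‖ = 1},
              |⟪w, A₂.symm (EuclideanSpace.single (2 : Fin 3) (1 : ℝ))⟫_ℝ| -
            Real.sqrt 2 * |⟪A₁ u₁, EuclideanSpace.single (2 : Fin 3) (1 : ℝ)⟫_ℝ| / 2) * Real.pi * ρ ^ 2 +
          C * (1 + h) * ρ := by
  obtain ⟨C₁, hC₁⟩ := affineSampleDeficit_upper A₁ t₁ 10 (by norm_num)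
  obtain ⟨C₂, hC₂⟩ := affineSampleDeficit_upper A₂ t₂ 10 (by norm_num)
  refine ⟨(240 * Real.sqrt 2 * Real.pi + 4440 * (4 * 10 + 2)) / 2 + 16000 + |C₁| + |C₂|, 10, by norm_num, ?_⟩
  intro h hh ρ hρ X P₁ P₂ hX hP₁X hP₂X hcell hP₁ hP₂
  set e₃ : EuclideanSpace ℝ (Fin 3) := EuclideanSpace.single (2 : Fin 3) (1 : ℝ) with he₃
  have he₃n : ‖e₃‖ = 1 := by rw [he₃, PiLp.norm_single, norm_one]
  have he₃i : ∀ d : EuclideanSpace ℝ (Fin 3), ⟪d, e₃⟫_ℝ = d 2 := fun d => by rw [he₃, EuclideanSpace.inner_single_right]; simp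
  set φ₁ : ℝ := Real.sqrt 2 / 4 * ∑ᶠ w ∈ {w ∈ fccStacking 1 (Real.sqrt (2 / 3)) | ‖w‖ = 1},
      |⟪w, A₁.symm (EuclideanSpace.single (2 : Fin 3) (1 : ℝ))⟫_ℝ| with hφ₁
  set φ₂ : ℝ := Real.sqrt 2 / 4 * ∑ᶠ w ∈ {w ∈ fccStacking 1 (Real.sqrt (2 / 3)) | ‖w‖ = 1},
      |⟪w, A₂.symm (EuclideanSpace.single (2 : Fin 3) (1 : ℝ))⟫_ℝ| with hφ₂
  have hP₂X' : P₂ ⊆ X := hP₂X.trans Finset.sdiff_subset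
  obtain ⟨hρ0, hρ1⟩ : (0 : ℝ) ≤ ρ ∧ (1 : ℝ) ≤ ρ := ⟨by linarith, by linarith⟩
  -- tilted drift `L`, fuel `N` (now depending on `ρ`), inner disc `ρs`
  set L : ℝ := 24 * (h + 4 * 10) with hL; have hL0 : 0 ≤ L := by rw [hL]; positivity
  set Hz : ℝ := ρ + h + 4 * 10 with hHz
  have hHz0 : 0 ≤ Hz := by rw [hHz]; positivity
  set N : ℕ := ⌈6 * Hz + 1⌉₊ with hNdef
  set ρs : ℝ := ρ - 3 - 24 * (h + 4 * 10) with hρs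
  set deg : EuclideanSpace ℝ (Fin 3) → ℕ := fun x => (X.filter fun q => dist x q = 1).card with hdeg
  have hdeg12 : ∀ x, deg x ≤ 12 := fun x => card_filter_dist_eq_one_le_twelve X hX x
  set PAY := X.filter fun y => (X.filter fun q => dist y q = 1).card ≠ 12 ∧
    -10 - 2 ≤ y 2 ∧ y 2 ≤ h + 10 + 2 with hPAY
  -- the weighted interior ledger
  have hled := ledger_ge_faces_add_interior_credits A₁ t₁ A₂ t₂ X P₁ P₂ 10 h ρ le_rfl hh hρ hX hcell hP₁X hP₂X'
    hP₁ hP₂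
  rw [← finsum_unit_fcc_symm_eq_sum_slots A₁, ← finsum_unit_fcc_symm_eq_sum_slots A₂, ← hφ₁, ← hφ₂, ← hPAY] at hled
  -- heights for the tilted vertical and the fuel
  have hH₁ : ∀ q ∈ X, ⟪q, z⟫_ℝ ≤ Hz := fun q hq => by
    have h1 := real_inner_le_norm q z
    rw [hz, mul_one] at h1
    exact h1.trans (norm_le_of_mem_cell (by norm_num) hh hρ0 (hcell q hq))
  have hlowz : ∀ q ∈ X, -Hz ≤ ⟪q, z⟫_ℝ := fun q hq => by
    have h1 := real_inner_le_norm (-q) z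
    rw [hz, mul_one, norm_neg, inner_neg_left] at h1
    have h2 := norm_le_of_mem_cell (R₀ := 10) (by norm_num) hh hρ0 (hcell q hq)
    linarith
  have hN : (6 : ℝ) * Hz + 1 ≤ (N : ℝ) := by rw [hNdef]; exact Nat.le_ceil _
  have hNh_of : ∀ q ∈ X, 8 * (Hz - ⟪q, z⟫_ℝ) < 3 * (N : ℝ) := fun q hq => by
    have := hlowz q hq; linarith
  -- fluxes
  set κ₁ : ℝ := Real.sqrt 2 * |⟪A₁ u₁, e₃⟫_ℝ| with hκ₁
  have hsq : 0 ≤ Real.sqrt 2 := Real.sqrt_nonneg 2; have hπ : Real.pi ≤ 4 := Real.pi_le_four; have hπ0 : 0 ≤ Real.pi := Real.pi_pos.le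
  have hs2' : Real.sqrt 2 ≤ 2 := by
    rw [show (2 : ℝ) = Real.sqrt (2 ^ 2) by rw [Real.sqrt_sq (by norm_num)]]; exact Real.sqrt_le_sqrt (by norm_num)
  have hκ₁0 : 0 ≤ κ₁ := mul_nonneg hsq (abs_nonneg _)
  have hκ₁2 : κ₁ ≤ 2 := by
    have := mul_le_mul hs2' (abs_inner_slot_le_one A₁ hu₁) (abs_nonneg _) (by norm_num); linarith
  -- the `e₃`-rise of the bottom slot under the tilt
  have hu3 : (11 / 30 : ℝ) ≤ ⟪A₁ u₁, e₃⟫_ℝ := slot_ref_rise_of_tilt_wide hze A₁ hu₁ hsteep₁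
  -- a second bottom entry, different from grain 1's (the count lemma is used with an EMPTY second family)
  have hu₁0 : A₁ u₁ ≠ 0 := fun h0 => by
    have := norm_eq_one_of_mem_fccSlots hu₁; rw [← LinearIsometryEquiv.norm_map A₁, h0, norm_zero] at this
    exact zero_ne_one this
  have hbb : (⟨A₁, u₁, 0⟩ : WalkEntry) ≠ ⟨A₁, u₁, A₁ u₁⟩ := fun hb => hu₁0 (congrArg WalkEntry.nrm hb).symm
  -- the main estimate: the payer sum dominates the tops, up to the flux loss
  have hmain : κ₁ * Real.pi * ρ ^ 2 - 16000 * (1 + h) * ρ ≤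
      (∑ y ∈ PAY, ((12 : ℝ) - ((X.filter fun q => dist y q = 1).card : ℝ))) := by
    have hPAY0 : 0 ≤ ∑ y ∈ PAY, ((12 : ℝ) - ((X.filter fun q => dist y q = 1).card : ℝ)) :=
      Finset.sum_nonneg fun y _ => by
        have h'' : ((X.filter fun q => dist y q = 1).card : ℝ) ≤ 12 := by exact_mod_cast hdeg12 y
        linarith
    by_cases hbig : 11 + L ≤ ρ
    · -- BIG CELL: run the walkers
      have hρs8 : 8 ≤ ρs := by rw [hρs]; linarith
      have hρs0 : 0 ≤ ρs := by linarith
      have hρs17 : ρs + 25 ≤ ρ - 1 := by rw [hρs]; linarith only [hh, hL, hL0]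
      have hρsρ : ρs ≤ ρ - 1 := by linarith only [hρs17]
      have hρs2 : ρs ^ 2 ≤ ρ ^ 2 := by nlinarith only [hρs0, hρsρ]
      have hρs3 : ρs ^ 2 ≤ (ρ - 1) ^ 2 := by nlinarith only [hρs0, hρsρ]
      -- the inner samples, tops and end-state maps
      set S₁ := P₁.filter fun p => (-19 : ℝ) ≤ p 2 ∧ p 2 ≤ -19 + 8 ∧ p 0 ^ 2 + p 1 ^ 2 ≤ ρs ^ 2 with hS₁def
      set T₁ := S₁.filter fun p => p + A₁ u₁ ∉ S₁ with hT₁def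
      set f₁ : EuclideanSpace ℝ (Fin 3) → EuclideanSpace ℝ (Fin 3) × List WalkEntry :=
        fun p => walkRun X z N (p + A₁ u₁, [⟨A₁, u₁, 0⟩]) with hf₁
      have hS₁mem : ∀ p, p ∈ S₁ ↔ (p ∈ P₁ ∧ (-19 : ℝ) ≤ p 2 ∧ p 2 ≤ -19 + 8 ∧ p 0 ^ 2 + p 1 ^ 2 ≤ ρs ^ 2) :=
        fun p => by rw [hS₁def, Finset.mem_filter]
      have hS₁ : ∀ p, p ∈ S₁ ↔ (p ∈ (fun q => A₁ q + t₁) '' fccStacking 1 (Real.sqrt (2 / 3)) ∧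
          (-19 : ℝ) ≤ p 2 ∧ p 2 ≤ -19 + 8 ∧ p 0 ^ 2 + p 1 ^ 2 ≤ ρs ^ 2) := by
        intro p
        rw [hS₁def, Finset.mem_filter, hP₁]
        constructor
        · rintro ⟨⟨hΛ, -, -, -⟩, h1, h2, h3⟩; exact ⟨hΛ, by linarith only [h1], by linarith only [h2], h3⟩
        · rintro ⟨hΛ, h1, h2, h3⟩
          exact ⟨⟨hΛ, by linarith only [h1], by linarith only [h2], by linarith only [h3, hρs2]⟩, h1, h2, h3⟩
      -- the tops count
      obtain ⟨Ea, Eb, hEa, hEb, hdet, hframe, -⟩ := exists_frame_of_mem_fccSlots hu₁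
      have hT₁ := tops_ge_lineCount A₁ t₁ (-19) 8 ρs (by norm_num) hρs8 S₁ hS₁ Ea Eb u₁ hEa hEb
        (norm_eq_one_of_mem_fccSlots hu₁) hdet hframe
      have hT₁' : κ₁ * Real.pi * ρs ^ 2 - 10 * Real.sqrt 2 * Real.pi * ρs ≤ (T₁.card : ℝ) := by rw [hT₁def]; exact hT₁
      have hflux : ∀ κ : ℝ, 0 ≤ κ → κ ≤ 2 → κ * Real.pi * ρ ^ 2 - 16000 * (1 + h) * ρ ≤ κ * Real.pi * ρs ^ 2 - 10 * Real.sqrt 2 * Real.pi * ρs :=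
        fun κ hκ0 hκ2 => flux_loss_inner_disc_wide hκ0 hκ2 hh hρ0 (by rw [hρs]) hρs0 hρsρ
      have hT₁'' : κ₁ * Real.pi * ρ ^ 2 - 16000 * (1 + h) * ρ ≤ (T₁.card : ℝ) := le_trans (hflux κ₁ hκ₁0 hκ₁2) hT₁'
      -- lateral bookkeeping
      have hlat_of : ∀ (y₀ y : EuclideanSpace ℝ (Fin 3)) (p : EuclideanSpace ℝ (Fin 3)) (v : EuclideanSpace ℝ (Fin 3)),
          y₀ = p + v → ‖v‖ = 1 → p 0 ^ 2 + p 1 ^ 2 ≤ ρs ^ 2 → ‖y - y₀‖ ≤ L → y 0 ^ 2 + y 1 ^ 2 ≤ (ρ - 2) ^ 2 := by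
        intro y₀ y p v hy₀ hv hp3 hd
        have h1 := sqrt_lateral_add_le y₀ (y - y₀); rw [add_sub_cancel] at h1
        have h2 := sqrt_lateral_add_le p v; rw [hv, ← hy₀] at h2
        have h3 : Real.sqrt (p 0 ^ 2 + p 1 ^ 2) ≤ ρs := by rw [← Real.sqrt_sq hρs0]; exact Real.sqrt_le_sqrt hp3
        have h4 : Real.sqrt (y 0 ^ 2 + y 1 ^ 2) ≤ ρ - 2 := by rw [hρs] at h3; linarith only [h1, h2, h3, hd, hL]
        have h7 := pow_le_pow_left₀ (Real.sqrt_nonneg (y 0 ^ 2 + y 1 ^ 2)) h4 2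
        rwa [Real.sq_sqrt (by positivity : (0 : ℝ) ≤ y 0 ^ 2 + y 1 ^ 2)] at h7
      have hsq_of_sqrt : ∀ (p : EuclideanSpace ℝ (Fin 3)), Real.sqrt (p 0 ^ 2 + p 1 ^ 2) ≤ ρ - 1 →
          p 0 ^ 2 + p 1 ^ 2 ≤ (ρ - 1) ^ 2 := by
        intro p hp
        have h7 := pow_le_pow_left₀ (Real.sqrt_nonneg (p 0 ^ 2 + p 1 ^ 2)) hp 2
        rwa [Real.sq_sqrt (by positivity : (0 : ℝ) ≤ p 0 ^ 2 + p 1 ^ 2)] at h7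
      -- GRAIN 1: fullness of the sample, end data, injectivity
      have hfull₁ : ∀ p ∈ S₁, p ∈ X ∧ ∀ w ∈ fccSlots, p + A₁ w ∈ X := by
        intro p hpS
        obtain ⟨hpΛ, hp1, hp2, hp3⟩ := (hS₁ p).1 hpS
        exact ⟨hP₁X ((hS₁mem p).1 hpS).1, fun w hw => hP₁X (inner_sample_full_window A₁ t₁ P₁ (-(2 * 10)) (-10) ρ hρ1
          hP₁ hpΛ (by linarith only [hp1]) (by linarith only [hp2]) (by linarith only [hp3, hρs3]) hw)⟩
      have hend₁ : ∀ t ∈ T₁, (f₁ t).1 ∈ PAY ∧ deg (f₁ t).1 ≤ 11 ∧ WalkInv X z (f₁ t) ∧ StackWF z (f₁ t).2 ∧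
          (f₁ t).2.getLast? = some ⟨A₁, u₁, 0⟩ ∧ (∃ e rest, (f₁ t).2 = e :: rest ∧ WalkCertified12 X (f₁ t).1 e) ∧
          ∀ e ∈ (f₁ t).2, e.frame ∈ M₁ := by
        intro p hp
        have hpS : p ∈ S₁ := by rw [hT₁def] at hp; exact (Finset.mem_filter.1 hp).1
        obtain ⟨hpΛ, hp1, hp2, hp3⟩ := (hS₁ p).1 hpS
        obtain ⟨hpX, hfull⟩ := hfull₁ p hpS
        have hy0X : p + A₁ u₁ ∈ X := hfull u₁ hu₁
        have hy02 : -20 ≤ (p + A₁ u₁) 2 := by linarith only [(hcell _ hy0X).1]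
        have hNh : 8 * (Hz - ⟪p + A₁ u₁, z⟫_ℝ) < 3 * (N : ℝ) := hNh_of _ hy0X
        have hI₀ : WalkInv X z (p + A₁ u₁, [⟨A₁, u₁, 0⟩]) := walkInv_start A₁ hpX hfull hu₁ hsteep₁
        obtain ⟨hyX, hydeg, -, hcone, -, -⟩ := stackWalk_end hX hs₀ hcert hz hH₁ hI₀ hNh
        have hfw' : walkRun X z N (p + A₁ u₁, [⟨A₁, u₁, 0⟩]) = f₁ p := rfl
        rw [hfw'] at hyX hydeg hcone
        obtain ⟨hrise, hdisp⟩ := disp_le_of_cone_of_tilt_ref_wide hze hcone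
        have hy0eq : (p + A₁ u₁) 2 = p 2 + ⟪A₁ u₁, e₃⟫_ℝ := by rw [PiLp.add_apply, ← he₃i (A₁ u₁)]
        rw [inner_sub_left, he₃i, he₃i] at hrise hdisp
        have hy2le : (f₁ p).1 2 ≤ h + 20 := by linarith only [(hcell _ hyX).2.1]
        have hlat2 := hlat_of (p + A₁ u₁) (f₁ p).1 p (A₁ u₁) rfl
          (by rw [LinearIsometryEquiv.norm_map, norm_eq_one_of_mem_fccSlots hu₁]) hp3
          (by rw [hL]; linarith only [hdisp, hy02, hy2le])
        have hvalid := walkRun_valid hX hs₀ hcert hz N hI₀ (stackWF_start z A₁ u₁)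
        have hlast₁ : (f₁ p).2.getLast? = some ⟨A₁, u₁, 0⟩ := by
          rw [← hfw', walkRun_getLast? hX hs₀ hcert hz N _ hI₀]; rfl
        have hfrM : ∀ e ∈ (f₁ p).2, e.frame ∈ M₁ := hM₁ (f₁ p).2 hvalid.1.2.1 hvalid.2 hlast₁
        have hnothigh := stackWalk_end_not_high_sep hX hs₀ hcert A₂ t₂ P₂ 10 h ρ (by linarith only [hρ]) hP₂X'
          (fun q hq => (hcell q hq).2.1) hP₂ hz hH₁ hI₀ hNh
          (fun e' he' => hfar e'.frame (hfrM e' (by rw [← hfw']; exact he'))) hlat2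
        rw [hfw'] at hnothigh
        have hylat : (f₁ p).1 0 ^ 2 + (f₁ p).1 1 ^ 2 ≤ (ρ - 1) ^ 2 := le_trans hlat2 (by nlinarith only [hρ])
        refine ⟨?_, hydeg, hvalid.1, hvalid.2, hlast₁, ?_, hfrM⟩
        · rw [hPAY, Finset.mem_filter]
          refine ⟨hyX, by show deg _ ≠ 12; exact fun h12 => by simp only [hdeg] at h12; omega, ?_, le_of_lt hnothigh⟩
          by_contra hlow; push Not at hlow
          exact not_unsaturated_in_slab A₁ t₁ (-(2 * 10)) (-10) ρ hρ1 X P₁ hX hP₁X hP₁ hyX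
            (by linarith only [hrise, hy0eq, hp1, hu3]) (by linarith only [hlow]) hylat hydeg
        · rw [← hfw']
          exact walkRun_certified12 hX hs₀ hcert hz hI₀ ⟨⟨A₁, u₁, 0⟩, [], rfl, Or.inl ⟨by simpa using hpX,
            fun w hw => by simp only [add_sub_cancel_right]; exact hfull w hw⟩⟩ N
      have hinj₁ : ∀ t ∈ T₁, ∀ t' ∈ T₁, f₁ t = f₁ t' → t = t' := by
        intro t ht t' ht' hft; rw [hT₁def, Finset.mem_filter] at ht ht'
        refine walkRun_start_injective_tilt_ref_wide hX hs₀ hcert hz e₃ A₁ t₁ hu₁ hsteep₁ S₁ (hlo := -19) (Hd := -11)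
          (ρ' := ρ - 1) hρs0 (fun p hp => ?_) (fun p hp => (hfull₁ p hp).2) (fun p hpX hpΛ hlo hhi hlat w hw => ?_)
          (by linarith only [hρs17])
          (sample_interval A₁ t₁ P₁ S₁ hρs0 (by linarith only [hρsρ]) (by norm_num) (by norm_num) hP₁ hS₁mem hu₁)
          hze ht.1 ht.2 ht'.1 ht'.2 hft
        · obtain ⟨hpΛ, hp1, hp2, hp3⟩ := (hS₁ p).1 hp
          exact ⟨(hfull₁ p hp).1, hpΛ, by rw [he₃i]; exact hp1, by rw [he₃i]; linarith only [hp2], hp3⟩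
        · rw [he₃i] at hlo hhi
          exact hP₁X (inner_sample_full_window A₁ t₁ P₁ (-(2 * 10)) (-10) ρ hρ1 hP₁ hpΛ (by linarith only [hlo])
            (by linarith only [hhi]) (hsq_of_sqrt p hlat) hw)
      -- THE COUNT: per payer ball, `deg + #fibre₁ ≤ 12` (the two-family count lemma with an EMPTY second family)
      have hpt : ∀ y ∈ PAY, deg y + (T₁.filter fun t => (f₁ t).1 = y).card ≤ 12 := by
        intro y hy
        set fib₁ := T₁.filter fun t => (f₁ t).1 = y with hfib₁
        by_cases hemp : fib₁ = ∅
        · rw [hemp, Finset.card_empty]; have := hdeg12 y; omega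
        -- `y` is an end ball: at most eleven contacts
        have hdegy : deg y ≤ 11 := by
          obtain ⟨t, ht⟩ := Finset.nonempty_iff_ne_empty.2 hemp
          obtain ⟨htT, hty⟩ := Finset.mem_filter.1 ht; have := (hend₁ t htT).2.1; rw [hty] at this; exact this
        set ES₁ := fib₁.image f₁ with hES₁
        have hc₁ : ES₁.card = fib₁.card := Finset.card_image_of_injOn fun t ht t' ht' hft =>
          hinj₁ t (Finset.mem_filter.1 ht).1 t' (Finset.mem_filter.1 ht').1 hft
        have key := card_contacts_add_endStates_le_twelve_sep hX hDS hCP M₁ (∅ : Set _)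
          (fun F₁ _ F₂ hF₂ => absurd hF₂ (Set.notMem_empty F₂)) hbb
          (z₁ := z) (z₂ := -e₃) hdegy ES₁ (∅ : Finset _) (fun s hs => ?_) (fun s hs => absurd hs (Finset.notMem_empty s))
        · rw [hc₁, Finset.card_empty, add_zero] at key; exact key
        · obtain ⟨t, ht, rfl⟩ := Finset.mem_image.1 hs
          obtain ⟨htT, hty⟩ := Finset.mem_filter.1 ht
          obtain ⟨-, -, hI, hW, hlast, hC, hfr⟩ := hend₁ t htT
          rw [hty] at hC; exact ⟨hty, hI, hW, hlast, hC, hfr⟩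
      -- summing over the payers
      have hsum₁ : T₁.card = ∑ y ∈ PAY, (T₁.filter fun t => (f₁ t).1 = y).card := Finset.card_eq_sum_card_fiberwise fun t ht => (hend₁ t ht).1
      have hcount : (T₁.card : ℝ) ≤ ∑ y ∈ PAY, ((12 : ℝ) - ((X.filter fun q => dist y q = 1).card : ℝ)) := by
        rw [hsum₁]
        push_cast
        refine Finset.sum_le_sum fun y hy => ?_
        have := hpt y hy
        have h' : (deg y : ℝ) + ((T₁.filter fun t => (f₁ t).1 = y).card : ℝ) ≤ 12 := by exact_mod_cast this
        simp only [hdeg] at h'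
        linarith
      linarith only [hcount, hT₁'']
    · -- SMALL CELL: the flux is within the error
      push Not at hbig
      have hsmall : κ₁ * Real.pi * ρ ^ 2 ≤ 16000 * (1 + h) * ρ := by
        have h1 : κ₁ * Real.pi ≤ 8 := by nlinarith only [hκ₁0, hκ₁2, hπ, hπ0]
        have h2 : κ₁ * Real.pi * ρ ^ 2 ≤ 8 * ρ ^ 2 := mul_le_mul_of_nonneg_right h1 (sq_nonneg ρ)
        have h3 : ρ ^ 2 ≤ ρ * (11 + L) := by rw [sq]; exact mul_le_mul_of_nonneg_left hbig.le hρ0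
        have hhρ : 0 ≤ h * ρ := mul_nonneg hh hρ0
        rw [hL] at h3; linarith only [h2, h3, hρ0, hhρ]
      linarith only [hsmall, hPAY0]
  -- the two upper slab counts and the two splits
  have hD₁ := hC₁ (-(2 * 10)) (-10) (by ring) ρ hρ P₁ hP₁; have hD₂ := hC₂ (h + 10) (h + 2 * 10) (by ring) ρ hρ P₂ hP₂
  have hsplit₁ := contactDeficiency_sdiff_split hP₁X; have hsplit₂ := contactDeficiency_sdiff_split hP₂X
  have htwo := two_mul_contactDeficiency_eq_sum X; have hhρ : 0 ≤ h * ρ := mul_nonneg hh hρ0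
  -- constants
  have hb : C₁ * ρ ≤ |C₁| * (1 + h) * ρ := by
    have h1 : 0 ≤ (|C₁| - C₁) * ρ := mul_nonneg (by linarith only [le_abs_self C₁]) hρ0
    have h2 : 0 ≤ |C₁| * h * ρ := by positivity
    linarith only [h1, h2]
  have hc' : C₂ * ρ ≤ |C₂| * (1 + h) * ρ := by
    have h1 : 0 ≤ (|C₂| - C₂) * ρ := mul_nonneg (by linarith only [le_abs_self C₂]) hρ0
    have h2 : 0 ≤ |C₂| * h * ρ := by positivity
    linarith only [h1, h2]
  -- assemble
  set SP : ℝ := ∑ y ∈ PAY, ((12 : ℝ) - ((X.filter fun q => dist y q = 1).card : ℝ)) with hSP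
  set C₀ : ℝ := 240 * Real.sqrt 2 * Real.pi + 4440 * (4 * 10 + 2) with hC₀
  have hDX : φ₁ * Real.pi * ρ ^ 2 + φ₂ * Real.pi * ρ ^ 2 + SP / 2 - C₀ * (1 + h) * ρ / 2 ≤ contactDeficiency X := by linarith only [hled, htwo]
  have hcross : ((((P₁ ×ˢ (X \ P₁)).filter fun pq => dist pq.1 pq.2 = 1).card : ℕ) : ℝ) +
      ((((P₂ ×ˢ ((X \ P₁) \ P₂)).filter fun pq => dist pq.1 pq.2 = 1).card : ℕ) : ℝ) =
      contactDeficiency P₁ + contactDeficiency P₂ + contactDeficiency ((X \ P₁) \ P₂) - contactDeficiency X := by linarith only [hsplit₁, hsplit₂]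
  rw [hcross]
  have hSP : κ₁ * Real.pi * ρ ^ 2 / 2 - 8000 * (1 + h) * ρ ≤ SP / 2 := by linarith only [hmain]
  have hC₀0 : 0 ≤ C₀ * (1 + h) * ρ := by positivity
  nlinarith only [hDX, hSP, hD₁, hD₂, hb, hc', hC₀0, hρ0, hh, hhρ]

end Summit.Ventures.Crystal3D.Theorems

end
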